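import Literature.NumberTheory.Transcendental.CurvePeriodsEllipticFormsProofs
import Mathlib.FieldTheory.AlgebraicClosure

/-!
# `RealOnePeriodRelations` (stmt-KontsevichZagierPeriods-10042), line `nash-retraction-thin-strip`,
# reshape 4 (the unconditional elliptic layer): stub `stub_ellForm`

FIRST AND SECOND KIND AS POLYNOMIAL FORMS.  On the affine Weierstrass curve `E_{A,B} : y² = f(x)`,
`f = x³ + Ax + B`, with `D = 4A³ + 27B² ≠ 0`, the tree's Bézout identity (`Weier.bezout`,
`Weier.eval_bezout`)

  `V f′ − U f = D`,  `U = 18Ax − 27B`, `V = 6Ax² − 9Bx + 4A²`, `f′ = 3x² + A`,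

gives `1/y = (V f′ − U y²)/(D y) = (V/D) · f′/y − (U/D) · y` at every point of the curve with `y ≠ 0`.
Hence the real abelian integrand of the first and second kind `P₁(x) + P₂(x) y + P₃(x)/y` is the
restriction of the polynomial 1-form `G dx + H dy` with

  `G = P₁ + (P₂ − P₃ U/D) · y`,  `H = (2/D) · P₃ V`,

in the sense `G + H · f′/(2y) = P₁ + P₂ y + P₃/y` (along the curve `dy = f′/(2y) dx`); both `G` and
`H` have algebraic coefficients when `A, B` and the coefficients of `P₁, P₂, P₃` are algebraic.
[folklore]
-/

noncomputable section

open scoped BigOperators Polynomial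
open Set MvPolynomial
open Literature.NumberTheory.Transcendental Literature.NumberTheory.Transcendental.CurvePeriods

namespace Summit.KontsevichZagierPeriods.SymplecticScissors.RealOnePeriodRelations.EllipticLayer

/-- The univariate polynomial `P_ℂ(x) ∈ ℂ[x, y]` (the complexification `P_ℂ` of a polynomial `P` with
real algebraic coefficients, in the variable `x`) evaluated at a real point `(x, y)` is `P(x)`.
[folklore] -/
theorem eval_eval₂_mapC_ell (P : Polynomial (algebraicClosure ℚ ℝ)) (x y : ℝ) :
    MvPolynomial.eval ![(x : ℂ), (y : ℂ)]
        (((P.map (algebraMap (algebraicClosure ℚ ℝ) ℝ)).map (algebraMap ℝ ℂ)).eval₂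
          (C : ℂ →+* MvPolynomial (Fin 2) ℂ) (X 0)) =
      ((Polynomial.aeval x P : ℝ) : ℂ) := by
  rw [Weier.eval_eval₂_X_zero, Matrix.cons_val_zero, Polynomial.eval_map,
    show (x : ℂ) = algebraMap ℝ ℂ x from rfl, Polynomial.eval₂_at_apply, Polynomial.eval_map,
    ← Polynomial.aeval_def]
  rfl

/-- `P_ℂ(x) ∈ ℂ[x, y]` has algebraic coefficients for `P` with real algebraic coefficients.
[folklore] -/
theorem hasAlgCoeffs_eval₂_mapC_ell (P : Polynomial (algebraicClosure ℚ ℝ)) :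
    HasAlgCoeffs (((P.map (algebraMap (algebraicClosure ℚ ℝ) ℝ)).map (algebraMap ℝ ℂ)).eval₂
      (C : ℂ →+* MvPolynomial (Fin 2) ℂ) (X 0)) :=
  Weier.hasAlgCoeffs_eval₂_X_zero fun n => by
    rw [Polynomial.coeff_map, Polynomial.coeff_map]
    exact (mem_algebraicClosure_iff.mp (P.coeff n).2).algebraMap.algebraMap

/-- **Stub `stub_ellForm`** — FIRST AND SECOND KIND AS POLYNOMIAL FORMS.  With the Bézout identity
`V f′ − U f = D` (`U = 18Ax − 27B`, `V = 6Ax² − 9Bx + 4A²`, `D = 4A³ + 27B²`) one has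
`1/y = (V/D) f′/y − (U/D) y` on `y² = f`, so `P₁ + P₂ y + P₃/y = G + H · f′/(2y)` with
`G = P₁ + (P₂ − P₃ U/D) y`, `H = (2/D) P₃ V` polynomial over `ℚ̄`. [folklore] -/
theorem stub_ellForm : ∀ (A B : ℝ), IsAlgebraic ℚ A → IsAlgebraic ℚ B → 4 * A ^ 3 + 27 * B ^ 2 ≠ 0 →
    ∀ (P₁ P₂ P₃ : Polynomial (algebraicClosure ℚ ℝ)),
    ∃ G H : MvPolynomial (Fin 2) ℂ, HasAlgCoeffs G ∧ HasAlgCoeffs H ∧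
      ∀ (x y : ℝ), y ^ 2 = x ^ 3 + A * x + B → y ≠ 0 →
        MvPolynomial.eval ![(x : ℂ), (y : ℂ)] G +
            MvPolynomial.eval ![(x : ℂ), (y : ℂ)] H * (((3 * x ^ 2 + A) / (2 * y) : ℝ) : ℂ) =
          ((Polynomial.aeval x P₁ + Polynomial.aeval x P₂ * y + Polynomial.aeval x P₃ / y : ℝ) : ℂ) := by
  intro A B hA hB hD P₁ P₂ P₃
  have hAC : IsAlgebraic ℚ (A : ℂ) := hA.algebraMap
  have hBC : IsAlgebraic ℚ (B : ℂ) := hB.algebraMap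
  have hDC : Weier.disc (A : ℂ) (B : ℂ) ≠ 0 := by
    show (4 * (A : ℂ) ^ 3 + 27 * (B : ℂ) ^ 2) ≠ 0
    exact_mod_cast hD
  have hDinv : IsAlgebraic ℚ (Weier.disc (A : ℂ) (B : ℂ))⁻¹ := (Weier.isAlgebraic_disc _ _ hAC hBC).inv
  refine ⟨((P₁.map (algebraMap (algebraicClosure ℚ ℝ) ℝ)).map (algebraMap ℝ ℂ)).eval₂
        (C : ℂ →+* MvPolynomial (Fin 2) ℂ) (X 0) +
      (((P₂.map (algebraMap (algebraicClosure ℚ ℝ) ℝ)).map (algebraMap ℝ ℂ)).eval₂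
          (C : ℂ →+* MvPolynomial (Fin 2) ℂ) (X 0) -
        ((P₃.map (algebraMap (algebraicClosure ℚ ℝ) ℝ)).map (algebraMap ℝ ℂ)).eval₂
          (C : ℂ →+* MvPolynomial (Fin 2) ℂ) (X 0) *
          (C (Weier.disc (A : ℂ) (B : ℂ))⁻¹ * Weier.uPol (A : ℂ) (B : ℂ))) * X 1,
    C (2 * (Weier.disc (A : ℂ) (B : ℂ))⁻¹) *
      ((P₃.map (algebraMap (algebraicClosure ℚ ℝ) ℝ)).map (algebraMap ℝ ℂ)).eval₂
          (C : ℂ →+* MvPolynomial (Fin 2) ℂ) (X 0) * Weier.vPol (A : ℂ) (B : ℂ),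
    ?_, ?_, ?_⟩
  · exact (hasAlgCoeffs_eval₂_mapC_ell P₁).add
      (((hasAlgCoeffs_eval₂_mapC_ell P₂).sub ((hasAlgCoeffs_eval₂_mapC_ell P₃).mul
        ((hasAlgCoeffs_C hDinv).mul (Weier.hasAlgCoeffs_uPol _ _ hAC hBC)))).mul (hasAlgCoeffs_X 1))
  · exact ((hasAlgCoeffs_C ((isAlgebraic_nat 2).mul hDinv)).mul (hasAlgCoeffs_eval₂_mapC_ell P₃)).mul
      (Weier.hasAlgCoeffs_vPol _ _ hAC hBC)
  · intro x y hxy hy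
    have hyC : (y : ℂ) ≠ 0 := by exact_mod_cast hy
    have hcurve : (y : ℂ) ^ 2 = (x : ℂ) ^ 3 + A * x + B := by exact_mod_cast hxy
    have hY : (y : ℂ) * (y : ℂ)⁻¹ = 1 := mul_inv_cancel₀ hyC
    have hE : Weier.disc (A : ℂ) (B : ℂ) * (Weier.disc (A : ℂ) (B : ℂ))⁻¹ = 1 := mul_inv_cancel₀ hDC
    have hbez := Weier.eval_bezout (A : ℂ) (B : ℂ) ![(x : ℂ), (y : ℂ)]
    rw [Weier.eval_pderiv_zero_fPoly, Weier.eval_fPoly] at hbez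
    simp only [Matrix.cons_val_zero] at hbez
    simp only [map_add, map_sub, map_mul, MvPolynomial.eval_C, MvPolynomial.eval_X,
      Matrix.cons_val_one, Matrix.cons_val_zero, eval_eval₂_mapC_ell,
      Complex.ofReal_add, Complex.ofReal_mul, Complex.ofReal_div, Complex.ofReal_pow,
      Complex.ofReal_ofNat]
    rw [div_eq_mul_inv, div_eq_mul_inv]
    linear_combination
      ((Weier.disc (A : ℂ) (B : ℂ))⁻¹ * ((Polynomial.aeval x P₃ : ℝ) : ℂ) * (y : ℂ)⁻¹) * hbez -
      ((Weier.disc (A : ℂ) (B : ℂ))⁻¹ * ((Polynomial.aeval x P₃ : ℝ) : ℂ) * (y : ℂ)⁻¹ *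
        MvPolynomial.eval ![(x : ℂ), (y : ℂ)] (Weier.uPol (A : ℂ) (B : ℂ))) * hcurve +
      ((Weier.disc (A : ℂ) (B : ℂ))⁻¹ * ((Polynomial.aeval x P₃ : ℝ) : ℂ) *
        MvPolynomial.eval ![(x : ℂ), (y : ℂ)] (Weier.uPol (A : ℂ) (B : ℂ)) * (y : ℂ)) * hY +
      (((Polynomial.aeval x P₃ : ℝ) : ℂ) * (y : ℂ)⁻¹) * hE

end Summit.KontsevichZagierPeriods.SymplecticScissors.RealOnePeriodRelations.EllipticLayer

end
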